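import Summits.QuantumFields.BalabanUV.Beta.GAN24.LayerTransportCells
import Summits.QuantumFields.BalabanUV.Beta.GAN24.LayerTransportUndressedThree
import Summits.QuantumFields.BalabanUV.Beta.GAN24.ContactKernelCells

/-!
# `BalabanUV.Beta.GAN24.LayerTransportLiteralSocket` — binder row G-an2-4 ∕ (CONV-C), W-slot CT-W, route «WC-TL» ∕ «QR-LL», row **(LT-Δ) «LAYER TRANSPORT»**, part (LT-LIT):
# **THE LITERAL's LAYER BOUND `hLT` FROM THREE GAUGE CELLS** — for the DRESSED composite legs `T = legChain (respStepBmSeq (toSite rr) Lc) (m+1) k` of the OWNER gan24-p1 g28's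
# leg-agnostic END (`WardRemainderEndThree.wLocStencil_unitS_three_of_layer`, hypothesis `hLT`): the telescope socket (`LayerTransportCells` §3) with the split of record
# `T = U + dzλ` (`ContactKernelCells.legChain_respStepBmSeq_sub_respStep`), the pure cell on `U = respStep (Lc^(m+1)) (Lc^(m+1+k+1))` DISCHARGED (`LayerTransportUndressedThree`),
# and the summable-class side conditions of both leg families DISCHARGED (leaf-12's `DressedLegEnvelope.exists_legChain_envelope`, leaf-02's `RespStepSecondDiff`) — so that
# `hLT` holds for the literal AS SOON AS the three one-gauge cells `push₃ (T−U) T T S`, `push₃ U (T−U) T S`, `push₃ U U (T−U) S` are bi-localised (K-LL-4, displayed)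

NOT IN PRINT; OUR BOOKKEEPING ([folklore] composition BY NAME; G-an2-4 formalisation swarm, leaf prover `b2b-balaban-gan24-formalise-leaf-01`, gen 65, INTENT I-leaf01-g65-4).  HONEST
FRAMING (cell contract, verbatim): «discharging `BetaPertH` makes Bałaban's UV stability UNCONDITIONAL — a real constructive-QFT result; it is NOT the continuum limit and NOT the Clay
problem.»  HONEST DEPENDENCY (verbatim): «continuum YM on T⁴ ⇐ BetaPertH ∧ nine spine estimates (0/9 proved); BetaPertH ⇐ (D1) ∧ (D4) ∧ CAP+tail; G-an2-4 gates asym, D1 and NE2/3/4.»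

## What (`d = 3`, `2 ≤ Lc`, in-block root `toSite rr`)
§1 side conditions from envelopes: `bdd_of_l1env ∕ summable_rows_of_l1env` (an (N1)-type `ℓ¹`-block envelope ⇒ bounded + summable fine rows — `Push4TwoRate.summable_leg`),
   and the dressed chain's via leaf-12's `supNorm` envelope (`Push3LegTelescope.abs_le_of_env' ∕ summable_of_env'`).
§2 **`exists_hLT_literal_of_gauge_cells`**: `∃ κ₀ A A′ A″` (level-free; leaf-02's) such that for every `0 < κ ≤ κ₀`, every `(m, k)`, all letter data meeting the letter-side rows
   of the (LT-3) END at `κ` (+ `LocStencil S Csl m′`, the class the telescope's additivity needs) and ANY three gauge-cell constants `K₁ K₂ K₃` with the three one-gauge cells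
   bi-localised at `U₀` with constants `Kᵢ·(√(Lc^(k+1)))⁻¹·e^{−η‖y−U₀‖₁}` (DISPLAYED — K-LL-4), the literal's cubic push satisfies the END's `hLT` with constant
   `(K₀ + K₁ + K₂ + K₃)·(√(Lc^(k+1)))⁻¹·e^{−η‖y−U₀‖₁}`, `K₀` = my END's explicit pure-cell constant, rate `κ∕4`, `η = min(κ∕2, δ∕2)`.
K-LL-4 is OPEN (my R-leaf01-g65-1 cell table: marginal × log by the typed mechanisms, one moment gain missing at the seams); this file claims NO gauge cell.  [folklore]; 0 cited facts,
0 `def`, 0 `def … : Prop`, 0 sorry.  NOTHING of (Q-R)∕(LT)∕(Q-L)∕(C)∕(S)∕«T2Shape»∕«T2Drift»∕(hW, hWall) discharged; NEVER «G-an2-4 closed» as (CONV-C); NOT D1, NOT `BetaPertH`, NOT continuum,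
NOT Clay.  2026-08-22; no existing file touched.
-/

noncomputable section

open Finset
open scoped BigOperators
open Literature.MathematicalPhysics.QuantumFieldTheory
open Literature.MathematicalPhysics.QuantumFieldTheory.Balaban1983to89
open Literature.MathematicalPhysics.QuantumFieldTheory.Balaban1983to89.Beta
open B12Sec2to5 (l1 l1_nonneg)
open B4ContourShift (supNorm)
open B6BondElimination (unitVec)
open ExpKernelCalculus (MKer Site BiLoc Zl)
open OneStepResolventKernel (Fib LocStencil)
open LatticeForm (quo)
open AffineAveraging (box toSite)
open BalabanCompositeJets (respStep)
open Summit.QuantumFields.BalabanUV.Beta.GAN24.Push4Iter (legChain)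
open Summit.QuantumFields.BalabanUV.Beta.GAN24.Push3 (push₃)
open Summit.QuantumFields.BalabanUV.Beta.GAN24.RespStepBmDecompExact (respStepBmSeq)
open Summit.QuantumFields.BalabanUV.Beta.GAN24.Push4TwoRate (summable_leg)
open Summit.QuantumFields.BalabanUV.Beta.GAN24.Push3LegTelescope (abs_le_of_env' summable_of_env')
open Summit.QuantumFields.BalabanUV.Beta.GAN24.DressedLegEnvelope (exists_legChain_envelope)
open Summit.QuantumFields.BalabanUV.Beta.GAN24.RespStepSecondDiff (exists_respStep_decay_grad_diff2_l1)
open Summit.QuantumFields.BalabanUV.Beta.GAN24.LayerTransportCells (biLoc_smul_push₃_of_telescope)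
open Summit.QuantumFields.BalabanUV.Beta.GAN24.LayerTransportUndressedThree (biLoc_cubic_push₃_respStep_three)

namespace Summit.QuantumFields.BalabanUV.Beta.GAN24.LayerTransportLiteralSocket

variable {d : ℕ}

/-! ## §1 Side conditions of the summable class from envelopes -/

/-- [folklore] An (N1)-type `ℓ¹`-block envelope bounds the leg by its constant (`P ≥ 0`, the exponential ≤ 1). -/
theorem bdd_of_l1env {f : Fin (d + 1) → (Fin (d + 1) → ℤ) → Fin (d + 1) → (Fin (d + 1) → ℤ) → ℝ} {L : ℕ} {P κ : ℝ} (hP : 0 ≤ P) (hκ : 0 ≤ κ)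
    (hf : ∀ μ z l'' w', |f μ z l'' w'| ≤ P * Real.exp (-κ * l1 (quo L w' - z))) :
    ∀ μ z l'' w', |f μ z l'' w'| ≤ P := fun μ z l'' w' =>
  (hf μ z l'' w').trans (mul_le_of_le_one_right hP (Real.exp_le_one_iff.2 (by nlinarith [l1_nonneg (quo L w' - z)])))

/-- [folklore] An (N1)-type `ℓ¹`-block envelope makes the fine rows summable (`Push4TwoRate.summable_leg`). -/
theorem summable_rows_of_l1env {f : Fin (d + 1) → (Fin (d + 1) → ℤ) → Fin (d + 1) → (Fin (d + 1) → ℤ) → ℝ} {L : ℕ} (hL : 1 ≤ L) {P κ : ℝ} (hκ : 0 < κ)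
    (hf : ∀ μ z l'' w', |f μ z l'' w'| ≤ P * Real.exp (-κ * l1 (quo L w' - z))) :
    ∀ μ z l'', Summable fun w' => f μ z l'' w' := fun μ z l'' =>
  Summable.of_norm_bounded ((summable_leg hL hκ z).mul_left P) (fun w' => by rw [Real.norm_eq_abs]; exact hf μ z l'' w')

/-! ## §2 The literal's `hLT` from three gauge cells -/

section Three

variable {Lc : ℕ} [NeZero Lc]

/-- NOT IN PRINT; OUR BOOKKEEPING.  **THE LITERAL's LAYER BOUND FROM THREE ONE-GAUGE CELLS** (`LayerTransportCells.biLoc_smul_push₃_of_telescope` ⨾ `LayerTransportUndressedThree` ⨾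
`ContactKernelCells.legChain_respStepBmSeq_sub_respStep` ⨾ the envelope side conditions of §1).  See the module header; `T − U = (μ z κ u ↦ dz (λ μ z) κ u)` by `ContactKernelCells` §1, so the
three displayed cells are ONE-GAUGE cells (K-LL-4). -/
theorem exists_hLT_literal_of_gauge_cells (hLc : 2 ≤ Lc) {rr : Fin (3 + 1) → ℕ} (hrr : rr ∈ box (3 + 1) Lc) :
    ∃ κ₀ A A' A'' : ℝ, 0 < κ₀ ∧ 0 ≤ A ∧ 0 ≤ A' ∧ 0 ≤ A'' ∧
      ∀ (m k : ℕ) (κ : ℝ), 0 < κ → κ ≤ κ₀ →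
      ∀ (S : Fin (3 + 1) → (Fin (3 + 1) → ℤ) → MKer (3 + 1) (Fib 3)) (ω : (Fin (3 + 1) → ℤ) → ℝ)
        (Z : Fin (3 + 1) → Fin (3 + 1) → Fin (3 + 1) → (Fin (3 + 1) → ℤ) → (Fin (3 + 1) → ℤ) → ℝ) (T' : Finset (Fin (3 + 1) → ℤ))
        (Cs Csl m' δ B δZ ρ CT : ℝ), κ < m' → 0 < δ → 0 ≤ Cs → 0 ≤ B → 4 * κ < δZ →
        LocStencil S Csl m' →
        (∀ k' u x z a b, |S k' u x z a b| ≤ Cs * ω u * Real.exp (-m' * (l1 (x - u) + l1 (z - u)))) →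
        ∀ (y : Fin (3 + 1) → ℤ),
        (∀ u, 0 ≤ ω u ∧ ω u ≤ ∑ μ : Fin (3 + 1),
          (∑ v ∈ ((box (3 + 1) (Lc ^ (k + 1))).filter (fun v => v μ = Lc ^ (k + 1) - 1)).image (fun v => ((Lc ^ (k + 1) : ℕ) : ℤ) • y + toSite v),
              Real.exp (-δ * l1 (v - u))
            + ∑ v ∈ ((box (3 + 1) (Lc ^ (k + 1))).filter (fun v => v μ = 0)).image (fun v => ((Lc ^ (k + 1) : ℕ) : ℤ) • y + toSite v - unitVec μ),
                Real.exp (-δ * l1 (v - u)))) →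
        (∀ k' κ₁ κ₂ u, ∑' x, ∑' z, S k' u x z (Sum.inl κ₁) (Sum.inl κ₂) = ∑ y' ∈ T', Z k' κ₁ κ₂ y' u) →
        (∀ k' κ₁ κ₂, ∀ y' ∈ T', ∀ e, |Z k' κ₁ κ₂ y' e| ≤ B * Real.exp (-δZ * l1 (e - y'))) →
        (∀ k' κ₁ κ₂, ∀ y' ∈ T', ∑' e, Z k' κ₁ κ₂ y' e = 0) →
        (∀ k' κ₁ κ₂, ∀ y' ∈ T', ∀ i : Fin (3 + 1), ∑' e, (((e - y') i : ℤ) : ℝ) * Z k' κ₁ κ₂ y' e = 0) →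
        (∀ y' ∈ T', l1 (quo (Lc ^ (k + 1)) y' - y) ≤ ρ) → ((T'.card : ℝ) ≤ CT * (((Lc ^ (k + 1) : ℕ) : ℝ)) ^ (3 + 1)) →
        ∀ (K₁ K₂ K₃ : ℝ) (ν : Fin (3 + 1)) (U₀ : Fin (3 + 1) → ℤ),
        BiLoc (((((Lc ^ (k + 1) : ℕ) : ℝ)) ^ (3 * (3 + 1))) •
            push₃ (legChain (respStepBmSeq (d := 3) (toSite rr) Lc) (m + 1) k - respStep (d := 3) (Lc ^ (m + 1)) (Lc ^ (m + 1 + k + 1)))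
              (legChain (respStepBmSeq (d := 3) (toSite rr) Lc) (m + 1) k) (legChain (respStepBmSeq (d := 3) (toSite rr) Lc) (m + 1) k) S ν U₀) U₀ U₀
          (K₁ * ((Real.sqrt (((Lc ^ (k + 1) : ℕ) : ℝ)))⁻¹ * Real.exp (-(min (κ / 2) (δ / 2)) * l1 (y - U₀)))) (κ / 4) →
        BiLoc (((((Lc ^ (k + 1) : ℕ) : ℝ)) ^ (3 * (3 + 1))) •
            push₃ (respStep (d := 3) (Lc ^ (m + 1)) (Lc ^ (m + 1 + k + 1)))
              (legChain (respStepBmSeq (d := 3) (toSite rr) Lc) (m + 1) k - respStep (d := 3) (Lc ^ (m + 1)) (Lc ^ (m + 1 + k + 1)))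
              (legChain (respStepBmSeq (d := 3) (toSite rr) Lc) (m + 1) k) S ν U₀) U₀ U₀
          (K₂ * ((Real.sqrt (((Lc ^ (k + 1) : ℕ) : ℝ)))⁻¹ * Real.exp (-(min (κ / 2) (δ / 2)) * l1 (y - U₀)))) (κ / 4) →
        BiLoc (((((Lc ^ (k + 1) : ℕ) : ℝ)) ^ (3 * (3 + 1))) •
            push₃ (respStep (d := 3) (Lc ^ (m + 1)) (Lc ^ (m + 1 + k + 1))) (respStep (d := 3) (Lc ^ (m + 1)) (Lc ^ (m + 1 + k + 1)))
              (legChain (respStepBmSeq (d := 3) (toSite rr) Lc) (m + 1) k - respStep (d := 3) (Lc ^ (m + 1)) (Lc ^ (m + 1 + k + 1))) S ν U₀) U₀ U₀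
          (K₃ * ((Real.sqrt (((Lc ^ (k + 1) : ℕ) : ℝ)))⁻¹ * Real.exp (-(min (κ / 2) (δ / 2)) * l1 (y - U₀)))) (κ / 4) →
        BiLoc (((((Lc ^ (k + 1) : ℕ) : ℝ)) ^ (3 * (3 + 1))) •
            push₃ (legChain (respStepBmSeq (d := 3) (toSite rr) Lc) (m + 1) k) (legChain (respStepBmSeq (d := 3) (toSite rr) Lc) (m + 1) k)
              (legChain (respStepBmSeq (d := 3) (toSite rr) Lc) (m + 1) k) S ν U₀) U₀ U₀
          (((((((3 : ℝ) + 1) ^ 3 * A ^ 2 * A' * Cs * (2 / (m' - κ) * Zl (3 + 1) ((m' - κ) / 2)) * (Zl (3 + 1) (m' - κ) + Zl (3 + 1) m'))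
            * ((2 * ((3 : ℝ) + 1)) ^ 2 * Zl (3 + 1) (δ / 2) * Real.exp (min (κ / 2) (δ / 2))))
        + ((3 : ℝ) + 1) ^ 3 *
          ((((A'' * A * A + 2 * A' * A' * A + A * A'' * A) * Real.exp (2 * κ) + 2 * ((A' * A + A * A') * Real.exp κ) * A' + A * A * A'')
              * Real.exp (2 * (2 * κ))) * B * (8 / (δZ - 2 * (2 * κ)) ^ 2 * Zl (3 + 1) ((δZ - 2 * (2 * κ)) / 4)) * Real.exp ((κ / 2) * ρ) * CT))
            + K₁ + K₂ + K₃) * ((Real.sqrt (((Lc ^ (k + 1) : ℕ) : ℝ)))⁻¹ * Real.exp (-(min (κ / 2) (δ / 2)) * l1 (y - U₀)))) (κ / 4) := by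
  obtain ⟨κ₀, A, A', A'', hκ₀, hA, hA', hA'', h0, h1, h2⟩ := exists_respStep_decay_grad_diff2_l1 (Lc := Lc)
  obtain ⟨κ₁, KT, hκ₁, hKT, hT⟩ := exists_legChain_envelope (Lc := Lc) hLc
  refine ⟨κ₀, A, A', A'', hκ₀, hA, hA', hA'', ?_⟩
  intro m k κ hκ hκκ₀ S ω Z T' Cs Csl m' δ B δZ ρ CT hm hδ hCs hB hκδZ hSl hS y hω hQ hZ hM0 hP1 hTl hTcard K₁ K₂ K₃ ν U₀ h₁ h₂ h₃
  have hL : 1 ≤ Lc ^ (k + 1) := Nat.one_le_pow _ _ (Nat.pos_of_ne_zero (NeZero.ne Lc))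
  -- the pure cell, legs discharged (INTENT 3)
  have h₀ := biLoc_cubic_push₃_respStep_three m k hκ hκκ₀ hA hA' hA'' (h0 (m + 1) k) (h1 (m + 1) k) (h2 (m + 1) k)
    hm hδ hCs hB hκδZ hS y hω hQ hZ hM0 hP1 hTl hTcard ν U₀
  -- side conditions of the summable class: the dressed chain via leaf-12's `supNorm` envelope, the undressed column via its `ℓ¹` envelope
  have hTenv := hT rr hrr (m + 1) k
  have hTb : ∀ α x' κ' x, |legChain (respStepBmSeq (d := 3) (toSite rr) Lc) (m + 1) k α x' κ' x| ≤ KT * ((Lc : ℝ) ^ (4 * (k + 1)))⁻¹ :=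
    abs_le_of_env' hκ₁.le hTenv
  have hTs : ∀ α x' κ', Summable fun x => legChain (respStepBmSeq (d := 3) (toSite rr) Lc) (m + 1) k α x' κ' x :=
    summable_of_env' hL hκ₁ hTenv
  have hP : 0 ≤ A * ((((Lc ^ (k + 1) : ℕ) : ℝ)) ^ (3 + 2))⁻¹ := by positivity
  have hUb := bdd_of_l1env hP hκ₀.le (h0 (m + 1) k)
  have hUs := summable_rows_of_l1env hL hκ₀ (h0 (m + 1) k)
  have h₀' : BiLoc (((((Lc ^ (k + 1) : ℕ) : ℝ)) ^ (3 * (3 + 1))) •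
      push₃ (respStep (d := 3) (Lc ^ (m + 1)) (Lc ^ (m + 1 + k + 1))) (respStep (d := 3) (Lc ^ (m + 1)) (Lc ^ (m + 1 + k + 1)))
        (respStep (d := 3) (Lc ^ (m + 1)) (Lc ^ (m + 1 + k + 1))) S ν U₀) U₀ U₀
      (((((((3 : ℝ) + 1) ^ 3 * A ^ 2 * A' * Cs * (2 / (m' - κ) * Zl (3 + 1) ((m' - κ) / 2)) * (Zl (3 + 1) (m' - κ) + Zl (3 + 1) m'))
            * ((2 * ((3 : ℝ) + 1)) ^ 2 * Zl (3 + 1) (δ / 2) * Real.exp (min (κ / 2) (δ / 2))))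
        + ((3 : ℝ) + 1) ^ 3 *
          ((((A'' * A * A + 2 * A' * A' * A + A * A'' * A) * Real.exp (2 * κ) + 2 * ((A' * A + A * A') * Real.exp κ) * A' + A * A * A'')
              * Real.exp (2 * (2 * κ))) * B * (8 / (δZ - 2 * (2 * κ)) ^ 2 * Zl (3 + 1) ((δZ - 2 * (2 * κ)) / 4)) * Real.exp ((κ / 2) * ρ) * CT))) * ((Real.sqrt (((Lc ^ (k + 1) : ℕ) : ℝ)))⁻¹ * Real.exp (-(min (κ / 2) (δ / 2)) * l1 (y - U₀)))) (κ / 4) :=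
    fun x z a b => (h₀ x z a b).trans (le_of_eq (by ring))
  exact biLoc_smul_push₃_of_telescope hTb hUb hTs hUs hSl (hκ.trans hm) _ ν U₀ h₀' h₁ h₂ h₃

end Three

end Summit.QuantumFields.BalabanUV.Beta.GAN24.LayerTransportLiteralSocket

end
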